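/-
Copyright (c) 2026 the pub-hodgecm-mathlib formalisation cell (harness21).  Prover seat hodgecm-mathlib-K2E3-p36 (g4) on the S4 valve (dealer K2E2-plan (g8), S4-R47 ∕ S4-R49 (3),
CARD E «TJ-LOC», file (TL-b′)): THE LOSS TWIN OF ★ (TJ2) `R90S4TwistedTubeCore` p864605 — the ε-twisted tube in the Cayley chart AT A NON-INTEGRAL BASE POINT, over ★ (TL-a)
`R90S4CayleyTwistedSlotLoss` p864716.  Crux H413 `stmt-HodgeConjecture-24833`, lane `--supports … --as helper` (count-neutral).
THEOREMS ONLY (no `def`, no `instance`, no notation, no named-fact hypothesis, no `sorry`).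
-/
import Summits.HodgeConjecture.HodgeConjecture.Theorems.R90S4TwistedTubeCore         -- ★ (TJ2) p864605: `symm_twisted_zero_mem_slot` (base-point free) + ★ C8b-core §1 sub-box kit, ★ C8a `tube_measure_eq`, ★ C4 level kit, ★ C2
import Summits.HodgeConjecture.HodgeConjecture.Theorems.R90S4CayleyTwistedSlotLoss    -- ★ (TL-a) p864716: `valBound_conj_of_valBound_of_le`, `cayley_twisted_triple_slot_of_valBound`, `valBound_twistedSandwich_slot_of_valBound`, `valBound_twistedSandwich_incr_slot_of_valBound`
import HarnessLib

/-!
# R90-TF · S4 (Ch. 13.1–2) · road (J̃♭) «TWISTED TUBE JACOBIAN», CARD E «TJ-LOC» file (TL-b′): THE ε-TWISTED TUBE IN THE CAYLEY CHART AT A NON-INTEGRAL BASE POINT —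
# the filtered Newton hypothesis `(N_L)`, the image box, the pointwise identity `c(X)·t₀·c(Y)·ε(c(X))⁻¹ = t₀·c(Θ_E(X ⊕ Y))` and the tube measure
# `κ·ν(t₀ • c(Θ_E A)) = χ(L_E)·μ(A)`, with a LOSS EXPONENT `a` and the START DEPTH `k ≥ k₀ + 2a` as explicit binders

Dealt by the S4 dealer K2E2-plan (g8) (S4-R47 2026-09-05T02:40:41Z, S4-R49 (3) 02:44:27Z) on K2E4-p11 (g10)'s census `K2/K2E4-p11/g10/CENSUS-TJ-LOC.md` 5dd07fbad23f3055
(VERDICT: «TJ-LOC» is not a separate road — the hyperbolic member `T = M` of the (J̃♭) letter is ★ (TJ2) + (TJ4) run base-point free) and this seat's census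
`K2/K2E3-p36/g4/CENSUS-TL-b-prime.md`.
THE POINT.  ★ (TJ2) `R90S4TwistedTubeCore` (the ε-twin of ★ C8b-core) takes the base point `t₀` INTEGRAL: `ValBound 1 (ρ t₀)`, `ValBound 1 (ρ t₀)⁻¹`.  That integrality enters at
exactly ONE algebraic point — the conjugated Cayley slot `W := T⁻¹·ι(pM Z)·T` — through ★ (TJ2) part 1's three calls (Newton increment, box stability, tube identity).  In the twisted
Weyl integration formula [Rogawski1990, §12.5 p. 186] at the hyperbolic member the base point `b₀ ∈ T̃` (`N b₀ ∈ M^{reg}`) is unbounded modulo `Z̃·(1−ε)T̃`, so `T = ρ(b₀)` is NOT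
integral; with `T ≤ γ`, `T⁻¹ ≤ γ′` entrywise the conjugate of a level-`i` element only lands in level `i − a`, where the LOSS EXPONENT `a` is any natural number with
`γ′·γ·α^a ≤ 1` (`a = ord_w λ(b₀)`, locally constant in `b₀`).  ★ (TL-a) p864716 states the three Cayley estimates with the conjugate bounds AS HYPOTHESES; this file re-runs
★ (TJ2)'s §2–§4 over them with the two honest changes of the hyperbolic case:
* the SANDWICH BOX is `a` levels shallower than the start depth (`Θ '' Λ′ k ⊆ Λ (k − a)`, stated subtraction-free as `Θ '' Λ′ k ⊆ Λ n` for `a + n ≤ k`);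
* the START DEPTH must exceed the shift `k₀` of `pM ∘ L⁻¹`, `pT ∘ L⁻¹` by `2a` (`k ≥ k₀ + 2a`): one `a` to put `W` back in the box, one `a` for the increment `T⁻¹·ι(pM y)·T`,
  so that the joint increment still lies one level deeper IN THE IMAGE FILTRATION `L(Λ′ •)` — which is all ★ C8a `F0P3cStCharTSTubeMeasureChart.tube_measure_eq` asks
  (its linear part is an ARBITRARY `L : V ≃ₜ+ V`, its Newton hypothesis is two-lattice, its chart box is any `S ⊇ Θ '' Λ′ k`; here `S = Λ 0` as in ★ (TJ2)).
SETTING = ★ (TJ2)'s frame VERBATIM (★ C4's `ι Λ ρ c`, complementary projections `pM pT`, sub-box `Λ′`, additive level-preserving third slot `E`, twist `ε` read in the chart by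
`hε : ρ(ε(c X))⁻¹ = cayley (E (ι X))` on `Λ 0`, linear part `ι (L Z) = T⁻¹ ι(pM Z) T + E (ι (pM Z)) + ι(pT Z)`), with `(hT1, hTinv1)` REPLACED IN PLACE by
`(hT : ValBound γ T) (hTinv : ValBound γ' Tinv) (hloss : γ' * γ * α ^ a ≤ 1)`, the shift hypotheses at `k₀`, and the depth threshold `hk`.
THE RESULTS (all PROVED).
* §1 **`valBound_conj_of_mem_level_loss`** — the one place the loss enters: `X ∈ Λ i`, `a + n ≤ i` ⇒ `T⁻¹·ι X·T ≤ α^(n+1)` (★ (TL-a) `valBound_conj_of_valBound_of_le` + level arithmetic).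
* §2 **`twisted_newton_slot_loss`** — `(N_{L_E})` from depth `k ≥ k₀ + 2a`: `Θ (x + y) − Θ x − L y ∈ L '' Λ′ (j + 1)` for `x ∈ Λ′ k`, `y ∈ Λ′ j`, `j ≥ k` (★ C8a's `hN` shape exactly);
  **`twisted_mem_level_slot_loss`** — the image box `Θ '' Λ′ k ⊆ Λ n` for `a + n ≤ k`.  (`Θ 0 = 0`, `L⁻¹ (Θ 0) ∈ Λ′ k` is ★ (TJ2) `symm_twisted_zero_mem_slot`, base-point free, by name.)
* §3 **`tube_eq_mul_chart_twisted_slot_loss`** — `c (pM Z) * t₀ * c (pT Z) * (ε (c (pM Z)))⁻¹ = t₀ * c (Θ Z)` for `Z ∈ Λ′ k`, `k ≥ a` (★ (TL-a) `cayley_twisted_triple_slot_of_valBound`).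
* §4 **`tube_measure_eq_twisted_slot_loss`** — `κ · ν (t₀ • c '' (Θ '' A)) = addEquivAddHaarChar L · μ A` for `A ⊆ Λ′ k`, `k ≥ k₀ + 2a` (★ C8a fed with §2; conclusion bytes = ★ (TJ2)'s).
★ (TJ2)'s four statements are the case `γ = γ′ = 1`, `a = 0`, `k₀ = k` (not restated).  NEXT ON THE ROAD: (TL-c′) the windows file at depth `k ≥ k₀(b₀) + 2a(b₀)` on a norm window
where `a`, `k₀` are constant (R90-C131-p04 (g3)); the weight `addEquivAddHaarChar L_E = cartanWeight (N b₀)` is ★ (TJ3) p864488 for every ε-regular `b₀`; the `M`-row assembly (K2E4-p11).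
[HarishChandra1970, Lemma 22], [Serre1992LALG, Part II Ch. IV §8–§9], [Rogawski1990, §12.5], [Labesse1999, §III.1].
HONEST LABEL: HC_CM is proved only modulo the 7 printed citations (2 remaining named inputs: hLiu418 = `stmt-HodgeConjecture-24832`, h413 = `stmt-HodgeConjecture-24833`)
until rung 0 closes; this file closes no organ ((J̃♭) stays OPEN, both rows, until (TL-c′)∕(TJ5)∕the `M`-row land); count-neutral helper.

## References
* [HarishChandra1970] Harish-Chandra (notes by G. van Dijk), *Harmonic Analysis on Reductive p-adic Groups*, LNM 162 (1970), Lemma 22 (the tube Jacobian at a Cartan subgroup).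
* [Serre1992LALG] J.-P. Serre, *Lie Algebras and Lie Groups*, LNM 1500 (1992), Part II Ch. IV §8–§9 (standard groups; filtrations by congruence levels).
* [Rogawski1990] J. Rogawski, *Automorphic Representations of Unitary Groups in Three Variables*, Ann. of Math. Stud. 123 (1990), §12.5 p. 186 (twisted Weyl integration).
* [Labesse1999] J.-P. Labesse, *Cohomologie, stabilisation et changement de base*, Astérisque 257 (1999), §III.1 (twisted Jacobian).
* [PlatonovRapinchuk1994] V. Platonov, A. Rapinchuk, *Algebraic Groups and Number Theory* (1994), §3.3 (congruence subgroups via the Cayley map).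
-/

set_option autoImplicit false
-- the mandated namespace repeats the single-problem summit's segment (`HodgeConjecture.HodgeConjecture`)
set_option linter.dupNamespace false

open Set Filter MeasureTheory MeasureTheory.Measure TopologicalSpace Topology Matrix ValuativeRel
open Literature.NumberTheory.Automorphic Literature.NumberTheory.Weil1982.UnitaryFinTopForm
open Summit.HodgeConjecture.HodgeConjecture.Cruxes.H413.F0P3cStCharTSCayleyChartHaar
open Summit.HodgeConjecture.HodgeConjecture.Cruxes.H413.F0P3cStCharTSTubeMeasureChart
open Summit.HodgeConjecture.HodgeConjecture.Cruxes.H413.F0P3cStCharTSTwistedTubeCore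
open scoped Pointwise Topology ENNReal MatrixGroups

namespace Summit.HodgeConjecture.HodgeConjecture.R90.S4

/-! ## §1 The one place the loss enters: conjugating a level by a non-integral base point -/

section Loss

variable {K : Type*} [Field K] [ValuativeRel K] {m : Type*} [Fintype m] [DecidableEq m]
  {V : Type*} [AddCommGroup V]
  (ι : V →+ Matrix m m K) (Λ : ℕ → AddSubgroup V) {α : ValueGroupWithZero K} {T Tinv : Matrix m m K} {γ γ' : ValueGroupWithZero K} {a : ℕ}

omit [DecidableEq m] in
/-- **THE LOSS EXPONENT IN LEVELS**: if the base point satisfies `T ≤ γ`, `T⁻¹ ≤ γ′` entrywise with `γ′·γ·α^a ≤ 1`, then conjugating a level-`i` element lands `a` levels higher at worst: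
`X ∈ Λ i`, `a + n ≤ i` ⇒ `T⁻¹·ι X·T ≤ α^(n+1)` (★ (TL-a) `valBound_conj_of_valBound_of_le`; at an integral base point `a = 0`).  This is the ONLY point where the non-integrality of the
hyperbolic base point of [Rogawski1990, §12.5] enters the tube estimates. [cite: PlatonovRapinchuk1994, §3.3] [cite: Serre1992LALG, Part II Ch. IV §9] [cite: Rogawski1990, §12.5 p. 186] -/
theorem valBound_conj_of_mem_level_loss (hΛ : ∀ j X, X ∈ Λ j ↔ ValBound (α ^ (j + 1)) (ι X)) (hα1 : α ≤ 1)
    (hT : ValBound γ T) (hTinv : ValBound γ' Tinv) (hloss : γ' * γ * α ^ a ≤ 1) {i n : ℕ} (hin : a + n ≤ i) {X : V} (hX : X ∈ Λ i) :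
    ValBound (α ^ (n + 1)) (Tinv * ι X * T) := by
  refine valBound_conj_of_valBound_of_le hT hTinv (valBound_of_mem_level ι Λ hΛ hX) ?_
  obtain ⟨d, rfl⟩ : ∃ d, i = a + (n + d) := ⟨i - a - n, by omega⟩
  calc γ' * α ^ (a + (n + d) + 1) * γ = (γ' * γ * α ^ a) * α ^ (n + d + 1) := by
        rw [show a + (n + d) + 1 = a + (n + d + 1) by omega, pow_add]
        simp only [mul_assoc, mul_comm]
    _ ≤ 1 * α ^ (n + d + 1) := mul_le_mul' hloss le_rfl
    _ = α ^ (n + d + 1) := one_mul _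
    _ ≤ α ^ (n + 1) := pow_le_pow_right_of_le_one' hα1 (by omega)

end Loss

/-! ## §2 The filtered Newton hypothesis `(N_L)` for the ε-twisted tube map from depth `k ≥ k₀ + 2a`, and the image box -/

section Newton

variable {K : Type*} [Field K] [ValuativeRel K] {m : Type*} [Fintype m] [DecidableEq m]
  {V : Type*} [AddCommGroup V] [TopologicalSpace V]
  (ι : V →+ Matrix m m K) (Λ : ℕ → AddSubgroup V) {α : ValueGroupWithZero K} (pM pT : V →+ V) {Λ' : ℕ → AddSubgroup V}
  (L : V ≃ₜ+ V) (Θ : V → V) (E : Matrix m m K →+ Matrix m m K) {T Tinv : Matrix m m K} {γ γ' : ValueGroupWithZero K} {a k₀ k : ℕ}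

/-- **`(N_L)` FOR THE ε-TWISTED TUBE MAP AT A NON-INTEGRAL BASE POINT**: `Θ (x + y) − Θ x − L y ∈ L '' Λ′ (j + 1)` for `x ∈ Λ′ k`, `y ∈ Λ′ j`, `j ≥ k`, with the linear part
`ι (L Z) = T⁻¹ ι(pM Z) T + E (ι (pM Z)) + ι(pT Z)`, provided `E` preserves the entrywise bounds (`hE`), `pM ∘ L⁻¹`, `pT ∘ L⁻¹` shift levels by at most `k₀` (`hshiftL`), the base point
loses at most `a` levels under conjugation (`hT hTinv hloss`), and the START DEPTH absorbs both: `k ≥ k₀ + 2a` (★ (TJ2) `twisted_newton_slot` is `a = 0`, `k₀ = k`).  Bookkeeping: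
`k = k₀ + 2a + e`, sandwich box `α^(k₀+a+e+1)`, increments `α^(k₀+a+e+f+1)` for `j = k + f`, joint increment (★ (TL-a) `valBound_twistedSandwich_incr_slot_of_valBound`) in
`Λ (2k₀ + 2a + 2e + f + 1) ⊆ Λ ((j + 1) + k₀)`. [cite: HarishChandra1970, Lemma 22] [cite: Serre1992LALG, Part II Ch. IV §8] [cite: Rogawski1990, §12.5 p. 186] [cite: Labesse1999, §III.1] -/
theorem twisted_newton_slot_loss (hΛ : ∀ j X, X ∈ Λ j ↔ ValBound (α ^ (j + 1)) (ι X)) (hα1 : α < 1)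
    (hΛ' : ∀ j Z, Z ∈ Λ' j ↔ (pM Z ∈ Λ j ∧ pT Z ∈ Λ j))
    (hT : ValBound γ T) (hTinv : ValBound γ' Tinv) (hloss : γ' * γ * α ^ a ≤ 1) (hk : k₀ + 2 * a ≤ k)
    (hE : ∀ (δ : ValueGroupWithZero K) (W : Matrix m m K), ValBound δ W → ValBound δ (E W))
    (hL : ∀ Z, ι (L Z) = Tinv * ι (pM Z) * T + E (ι (pM Z)) + ι (pT Z))
    (hΘ : ∀ Z ∈ Λ' k, ι (Θ Z) =
      (fun W X : Matrix m m K => (1 - W)⁻¹ * (W + X) * (1 + W * X)⁻¹ * (1 - W)) (Tinv * ι (pM Z) * T)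
        ((fun W X : Matrix m m K => (1 - W)⁻¹ * (W + X) * (1 + W * X)⁻¹ * (1 - W)) (ι (pT Z)) (E (ι (pM Z)))))
    (hshiftL : ∀ j, ∀ Z ∈ Λ (j + k₀), pM (L.symm Z) ∈ Λ j ∧ pT (L.symm Z) ∈ Λ j) :
    ∀ j, k ≤ j → ∀ x ∈ Λ' k, ∀ y ∈ Λ' j, Θ (x + y) - Θ x - L y ∈ L '' (Λ' (j + 1) : Set V) := by
  intro j hj x hx y hy
  -- depth bookkeeping: `k = k₀ + 2a + e`, `j = k + f`
  obtain ⟨e, rfl⟩ : ∃ e, k = k₀ + 2 * a + e := ⟨k - (k₀ + 2 * a), by omega⟩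
  obtain ⟨f, rfl⟩ : ∃ f, j = k₀ + 2 * a + e + f := ⟨j - (k₀ + 2 * a + e), by omega⟩
  have hanti := level_antitone ι Λ hΛ hα1.le
  have hanti' : Antitone Λ' := subBox_antitone hΛ' hanti
  have hxy : x + y ∈ Λ' (k₀ + 2 * a + e) := add_mem hx (hanti' hj hy)
  obtain ⟨hxM, hxT⟩ := (hΛ' _ x).1 hx
  obtain ⟨hyM, hyT⟩ := (hΛ' _ y).1 hy
  -- the radii: sandwich box `ρ′ = α^(k₀+a+e+1)`, increments `γ₁ = α^(k₀+a+e+f+1)`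
  have hρ' : α ^ (k₀ + a + e + 1) < 1 := pow_lt_one₀ zero_le hα1 (Nat.succ_ne_zero _)
  have hγ₁ : α ^ (k₀ + a + e + f + 1) ≤ α ^ (k₀ + a + e + 1) := pow_le_pow_right_of_le_one' hα1.le (by omega)
  -- the conjugated slots (the loss, §1)
  have hW : ValBound (α ^ (k₀ + a + e + 1)) (Tinv * ι (pM x) * T) :=
    valBound_conj_of_mem_level_loss ι Λ hΛ hα1.le hT hTinv hloss (by omega) hxM
  have hD : ValBound (α ^ (k₀ + a + e + f + 1)) (Tinv * ι (pM y) * T) :=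
    valBound_conj_of_mem_level_loss ι Λ hΛ hα1.le hT hTinv hloss (by omega) hyM
  -- the other slots sit deeper than needed
  have hY : ValBound (α ^ (k₀ + a + e + 1)) (ι (pT x)) :=
    (valBound_of_mem_level ι Λ hΛ hxT).mono (pow_le_pow_right_of_le_one' hα1.le (by omega))
  have hEX : ValBound (α ^ (k₀ + a + e + 1)) (E (ι (pM x))) :=
    (hE _ _ (valBound_of_mem_level ι Λ hΛ hxM)).mono (pow_le_pow_right_of_le_one' hα1.le (by omega))
  have hY₁ : ValBound (α ^ (k₀ + a + e + f + 1)) (ι (pT y)) :=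
    (valBound_of_mem_level ι Λ hΛ hyT).mono (pow_le_pow_right_of_le_one' hα1.le (by omega))
  have hEX₁ : ValBound (α ^ (k₀ + a + e + f + 1)) (E (ι (pM y))) :=
    (hE _ _ (valBound_of_mem_level ι Λ hΛ hyM)).mono (pow_le_pow_right_of_le_one' hα1.le (by omega))
  -- ★ (TL-a): the filtered Newton increment with the conjugate bounds as hypotheses
  have key := valBound_twistedSandwich_incr_slot_of_valBound hρ' hγ₁ E hW hD hY hY₁ hEX hEX₁
  -- the same element, read in `V`
  have hιE : ι (Θ (x + y) - Θ x - L y)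
      = (fun W X : Matrix m m K => (1 - W)⁻¹ * (W + X) * (1 + W * X)⁻¹ * (1 - W)) (Tinv * (ι (pM x) + ι (pM y)) * T)
        ((fun W X : Matrix m m K => (1 - W)⁻¹ * (W + X) * (1 + W * X)⁻¹ * (1 - W)) (ι (pT x) + ι (pT y)) (E (ι (pM x) + ι (pM y))))
      - (fun W X : Matrix m m K => (1 - W)⁻¹ * (W + X) * (1 + W * X)⁻¹ * (1 - W)) (Tinv * ι (pM x) * T)
        ((fun W X : Matrix m m K => (1 - W)⁻¹ * (W + X) * (1 + W * X)⁻¹ * (1 - W)) (ι (pT x)) (E (ι (pM x))))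
      - (Tinv * ι (pM y) * T + E (ι (pM y)) + ι (pT y)) := by
    rw [map_sub, map_sub, hΘ _ hxy, hΘ _ hx, hL y, map_add, map_add, map_add, map_add]
  have hEmem : Θ (x + y) - Θ x - L y ∈ Λ (2 * k₀ + 2 * a + 2 * e + f + 1) := by
    refine (hΛ _ _).2 ?_
    rw [hιE, show 2 * k₀ + 2 * a + 2 * e + f + 1 + 1 = (k₀ + a + e + 1) + (k₀ + a + e + f + 1) by omega, pow_add]
    exact key
  -- slack `e`: down to the shifted image level `(j + 1) + k₀`
  have hEmem' : Θ (x + y) - Θ x - L y ∈ Λ ((k₀ + 2 * a + e + f + 1) + k₀) := hanti (by omega) hEmem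
  obtain ⟨h1, h2⟩ := hshiftL (k₀ + 2 * a + e + f + 1) _ hEmem'
  exact ⟨L.symm (Θ (x + y) - Θ x - L y), (hΛ' _ _).2 ⟨h1, h2⟩, L.apply_symm_apply _⟩

omit [TopologicalSpace V] in
/-- **THE IMAGE BOX AT A NON-INTEGRAL BASE POINT**: the ε-twisted tube map sends the depth-`k` sub-box into the level `Λ n` whenever `a + n ≤ k` (`n = k − a`: the sandwich box is `a` levels
shallower than the start depth; ★ (TJ2) `twisted_mem_level_slot` is `a = 0`, `n = k`) — ★ (TL-a) `valBound_twistedSandwich_slot_of_valBound` at the common radius `α^(n+1)`.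
[cite: Serre1992LALG, Part II Ch. IV §8] [cite: Rogawski1990, §12.5 p. 186] -/
theorem twisted_mem_level_slot_loss (hΛ : ∀ j X, X ∈ Λ j ↔ ValBound (α ^ (j + 1)) (ι X)) (hα1 : α < 1)
    (hΛ' : ∀ j Z, Z ∈ Λ' j ↔ (pM Z ∈ Λ j ∧ pT Z ∈ Λ j))
    (hT : ValBound γ T) (hTinv : ValBound γ' Tinv) (hloss : γ' * γ * α ^ a ≤ 1) {n : ℕ} (hk : a + n ≤ k)
    (hE : ∀ (δ : ValueGroupWithZero K) (W : Matrix m m K), ValBound δ W → ValBound δ (E W))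
    (hΘ : ∀ Z ∈ Λ' k, ι (Θ Z) =
      (fun W X : Matrix m m K => (1 - W)⁻¹ * (W + X) * (1 + W * X)⁻¹ * (1 - W)) (Tinv * ι (pM Z) * T)
        ((fun W X : Matrix m m K => (1 - W)⁻¹ * (W + X) * (1 + W * X)⁻¹ * (1 - W)) (ι (pT Z)) (E (ι (pM Z))))) :
    ∀ Z ∈ Λ' k, Θ Z ∈ Λ n := by
  intro Z hZ
  obtain ⟨hZM, hZT⟩ := (hΛ' k Z).1 hZ
  have hρ : α ^ (n + 1) < 1 := pow_lt_one₀ zero_le hα1 (Nat.succ_ne_zero n)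
  have hle : α ^ (k + 1) ≤ α ^ (n + 1) := pow_le_pow_right_of_le_one' hα1.le (by omega)
  rw [hΛ, hΘ Z hZ]
  exact valBound_twistedSandwich_slot_of_valBound (valBound_conj_of_mem_level_loss ι Λ hΛ hα1.le hT hTinv hloss hk hZM)
    ((valBound_of_mem_level ι Λ hΛ hZT).mono hle) ((hE _ _ (valBound_of_mem_level ι Λ hΛ hZM)).mono hle) hρ

end Newton

/-! ## §3 The pointwise ε-twisted tube identity in `G` at a non-integral base point -/

section Tube

variable {K : Type*} [Field K] [ValuativeRel K] {m : Type*} [Fintype m] [DecidableEq m]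
  {V : Type*} [AddCommGroup V] {G : Type*} [Group G]
  (ι : V →+ Matrix m m K) (Λ : ℕ → AddSubgroup V) {α : ValueGroupWithZero K} (ρ : G →* GL m K) (c : V → G)
  (pM pT : V →+ V) {Λ' : ℕ → AddSubgroup V} (Θ : V → V) (E : Matrix m m K →+ Matrix m m K) (ε : G → G) (t₀ : G)
  {γ γ' : ValueGroupWithZero K} {a k : ℕ}

/-- **THE ε-TWISTED TUBE IDENTITY AT A NON-INTEGRAL BASE POINT**: `c (pM Z) · t₀ · c (pT Z) · ε(c (pM Z))⁻¹ = t₀ · c (Θ Z)` for `Z ∈ Λ′ k`, `k ≥ a`, where the twist is read in the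
chart by `ρ(ε(c X))⁻¹ = cayley (E (ι X))` on `Λ 0` and the base point `T = ρ t₀` satisfies `T ≤ γ`, `T⁻¹ ≤ γ′`, `γ′γα^a ≤ 1` (★ (TJ2) `tube_eq_mul_chart_twisted_slot` is `T`, `T⁻¹`
integral) — ★ (TL-a) `cayley_twisted_triple_slot_of_valBound` at the common radius `α^(k−a+1)`; `ρ` injective. [cite: Rogawski1990, §12.5 p. 186] [cite: HarishChandra1970, Lemma 22]
[cite: PlatonovRapinchuk1994, §3.3] -/
theorem tube_eq_mul_chart_twisted_slot_loss (hΛ : ∀ j X, X ∈ Λ j ↔ ValBound (α ^ (j + 1)) (ι X)) (hα1 : α < 1) (hρinj : Function.Injective ρ)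
    (hc : ∀ X ∈ Λ 0, ((ρ (c X) : GL m K) : Matrix m m K) = cayley (ι X))
    (hΛ' : ∀ j Z, Z ∈ Λ' j ↔ (pM Z ∈ Λ j ∧ pT Z ∈ Λ j))
    (hT : ValBound γ ((ρ t₀ : GL m K) : Matrix m m K)) (hTinv : ValBound γ' (((ρ t₀)⁻¹ : GL m K) : Matrix m m K)) (hloss : γ' * γ * α ^ a ≤ 1) (hk : a ≤ k)
    (hE : ∀ (δ : ValueGroupWithZero K) (W : Matrix m m K), ValBound δ W → ValBound δ (E W))
    (hε : ∀ X ∈ Λ 0, (((ρ (ε (c X)))⁻¹ : GL m K) : Matrix m m K) = cayley (E (ι X)))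
    (hΘ : ∀ Z ∈ Λ' k, ι (Θ Z) =
      (fun W X : Matrix m m K => (1 - W)⁻¹ * (W + X) * (1 + W * X)⁻¹ * (1 - W)) ((((ρ t₀)⁻¹ : GL m K) : Matrix m m K) * ι (pM Z) * ((ρ t₀ : GL m K) : Matrix m m K))
        ((fun W X : Matrix m m K => (1 - W)⁻¹ * (W + X) * (1 + W * X)⁻¹ * (1 - W)) (ι (pT Z)) (E (ι (pM Z)))))
    {Z : V} (hZ : Z ∈ Λ' k) :
    c (pM Z) * t₀ * c (pT Z) * (ε (c (pM Z)))⁻¹ = t₀ * c (Θ Z) := by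
  -- depth bookkeeping: `k = a + n`, common radius `α^(n+1)`
  obtain ⟨n, rfl⟩ : ∃ n, k = a + n := ⟨k - a, by omega⟩
  have hanti := level_antitone ι Λ hΛ hα1.le
  obtain ⟨hM, hTZ⟩ := (hΛ' _ Z).1 hZ
  have hM0 : pM Z ∈ Λ 0 := hanti (Nat.zero_le _) hM
  have hT0 : pT Z ∈ Λ 0 := hanti (Nat.zero_le _) hTZ
  have hΘ0 : Θ Z ∈ Λ 0 := hanti (Nat.zero_le n)
    (twisted_mem_level_slot_loss ι Λ pM pT Θ E hΛ hα1 hΛ' hT hTinv hloss le_rfl hE hΘ Z hZ)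
  have hr : α ^ (n + 1) < 1 := pow_lt_one₀ zero_le hα1 (Nat.succ_ne_zero n)
  have hle : α ^ (a + n + 1) ≤ α ^ (n + 1) := pow_le_pow_right_of_le_one' hα1.le (by omega)
  -- read everything in `GL m K`, then in matrices
  apply hρinj
  apply Units.ext
  simp only [map_mul, map_inv, Units.val_mul]
  rw [hε _ hM0, hc _ hM0, hc _ hT0, hc _ hΘ0, hΘ Z hZ]
  have hTT : ((ρ t₀ : GL m K) : Matrix m m K) * (((ρ t₀)⁻¹ : GL m K) : Matrix m m K) = 1 := by
    rw [← Units.val_mul, mul_inv_cancel, Units.val_one]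
  have hTT' : (((ρ t₀)⁻¹ : GL m K) : Matrix m m K) * ((ρ t₀ : GL m K) : Matrix m m K) = 1 := by
    rw [← Units.val_mul, inv_mul_cancel, Units.val_one]
  have key := cayley_twisted_triple_slot_of_valBound hTT hTT' ((valBound_of_mem_level ι Λ hΛ hM).mono hle)
    (valBound_conj_of_mem_level_loss ι Λ hΛ hα1.le hT hTinv hloss le_rfl hM)
    ((valBound_of_mem_level ι Λ hΛ hTZ).mono hle) ((hE _ _ (valBound_of_mem_level ι Λ hΛ hM)).mono hle) hr
  -- `c(X) T c(Y) c(E X) = T · (T⁻¹ c(X) T c(Y) c(E X))`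
  calc cayley (ι (pM Z)) * ((ρ t₀ : GL m K) : Matrix m m K) * cayley (ι (pT Z)) * cayley (E (ι (pM Z)))
      = ((ρ t₀ : GL m K) : Matrix m m K) * ((((ρ t₀)⁻¹ : GL m K) : Matrix m m K) * cayley (ι (pM Z)) * ((ρ t₀ : GL m K) : Matrix m m K)
          * cayley (ι (pT Z)) * cayley (E (ι (pM Z)))) := by
        rw [show ((ρ t₀ : GL m K) : Matrix m m K) * ((((ρ t₀)⁻¹ : GL m K) : Matrix m m K) * cayley (ι (pM Z)) * ((ρ t₀ : GL m K) : Matrix m m K)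
            * cayley (ι (pT Z)) * cayley (E (ι (pM Z))))
            = (((ρ t₀ : GL m K) : Matrix m m K) * (((ρ t₀)⁻¹ : GL m K) : Matrix m m K)) * cayley (ι (pM Z)) * ((ρ t₀ : GL m K) : Matrix m m K)
              * cayley (ι (pT Z)) * cayley (E (ι (pM Z))) by simp only [Matrix.mul_assoc], hTT, Matrix.one_mul]
    _ = ((ρ t₀ : GL m K) : Matrix m m K) * cayley _ := by rw [key]

end Tube

/-! ## §4 The ε-twisted tube measure at a non-integral base point -/

section TubeMeasure

variable {K : Type*} [Field K] [ValuativeRel K] [TopologicalSpace K] [IsNonarchimedeanLocalField K]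
  {m : Type*} [Fintype m] [DecidableEq m]
  {V : Type*} [AddCommGroup V] [TopologicalSpace V] [IsTopologicalAddGroup V] [T2Space V] [SecondCountableTopology V]
  [LocallyCompactSpace V] [MeasurableSpace V] [BorelSpace V]
  {G : Type*} [Group G] [MeasurableSpace G]
  (ι : V →+ Matrix m m K) (Λ : ℕ → AddSubgroup V) {α : ValueGroupWithZero K} (c : V → G)
  (pM pT : V →+ V) {Λ' : ℕ → AddSubgroup V} (L : V ≃ₜ+ V) (Θ : V → V) (E : Matrix m m K →+ Matrix m m K) {T Tinv : Matrix m m K}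
  {γ γ' : ValueGroupWithZero K} {a k₀ k : ℕ}
  (μ : Measure V) [μ.IsAddHaarMeasure] (ν : Measure G) [ν.IsMulLeftInvariant]

/-- **THE ε-TWISTED TUBE MEASURE AT A NON-INTEGRAL BASE POINT**: `κ · ν (t₀ • c '' (Θ '' A)) = addEquivAddHaarChar L · μ A` for `A ⊆ Λ′ k` with Borel images, from the START DEPTH
`k ≥ k₀ + 2a` on (`k₀` = the level shift of `pM`, `pT`, `pM ∘ L⁻¹`, `pT ∘ L⁻¹`; `a` = the loss exponent of the base point, `γ′γα^a ≤ 1`), where `κ · ν (c '' B) = μ B` on `Λ 0`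
(★ C4∕C4u) — ★ C8a `tube_measure_eq` on the sub-box filtration fed with §2 (`(N_L)`, image box `⊆ Λ 0`) and ★ (TJ2) `symm_twisted_zero_mem_slot`; ★ (TJ2)
`tube_measure_eq_twisted_slot` is `a = 0`, `k₀ = k`.  At the datum `addEquivAddHaarChar L_E = cartanWeight (N b₀)` by ★ (TJ3) p864488, for every ε-regular `b₀`, bounded or not.
[cite: HarishChandra1970, Lemma 22] [cite: Rogawski1990, §12.5 p. 186] [cite: Labesse1999, §III.1] -/
theorem tube_measure_eq_twisted_slot_loss (hι : IsClosedEmbedding ι) (hΛ : ∀ j X, X ∈ Λ j ↔ ValBound (α ^ (j + 1)) (ι X)) (hα : α ≠ 0) (hα1 : α < 1)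
    (hΛ' : ∀ j Z, Z ∈ Λ' j ↔ (pM Z ∈ Λ j ∧ pT Z ∈ Λ j)) (hsum : ∀ Z, pM Z + pT Z = Z)
    (hshift : ∀ j, ∀ Z ∈ Λ (j + k₀), pM Z ∈ Λ j ∧ pT Z ∈ Λ j)
    (hT : ValBound γ T) (hTinv : ValBound γ' Tinv) (hloss : γ' * γ * α ^ a ≤ 1) (hk : k₀ + 2 * a ≤ k)
    (hE : ∀ (δ : ValueGroupWithZero K) (W : Matrix m m K), ValBound δ W → ValBound δ (E W))
    (hL : ∀ Z, ι (L Z) = Tinv * ι (pM Z) * T + E (ι (pM Z)) + ι (pT Z))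
    (hΘ : ∀ Z ∈ Λ' k, ι (Θ Z) =
      (fun W X : Matrix m m K => (1 - W)⁻¹ * (W + X) * (1 + W * X)⁻¹ * (1 - W)) (Tinv * ι (pM Z) * T)
        ((fun W X : Matrix m m K => (1 - W)⁻¹ * (W + X) * (1 + W * X)⁻¹ * (1 - W)) (ι (pT Z)) (E (ι (pM Z)))))
    (hΘc : ContinuousOn Θ (Λ' k : Set V))
    (hshiftL : ∀ j, ∀ Z ∈ Λ (j + k₀), pM (L.symm Z) ∈ Λ j ∧ pT (L.symm Z) ∈ Λ j)
    {κ : ℝ≥0∞} (hchart : ∀ B ⊆ (Λ 0 : Set V), MeasurableSet (c '' B) → κ * ν (c '' B) = μ B)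
    (t₀ : G) {A : Set V} (hA : A ⊆ (Λ' k : Set V)) (hAm : MeasurableSet (Θ '' A)) (hAcm : MeasurableSet (c '' (Θ '' A))) :
    κ * ν (t₀ • (c '' (Θ '' A))) = addEquivAddHaarChar L * μ A := by
  have hanti := level_antitone ι Λ hΛ hα1.le
  have hopenΛ := isOpen_level ι Λ hι.continuous hΛ hα
  have hcompΛ := isCompact_level ι Λ hι hΛ
  refine tube_measure_eq Λ' Θ L μ c ν (subBox_antitone hΛ' hanti) (isOpen_subBox hΛ' hopenΛ hshift)
    (isCompact_subBox hΛ' hopenΛ hcompΛ hshift hsum k)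
    (subBox_basis hΛ' hsum (exists_level_subset_of_mem_nhds ι Λ hι hΛ hα1)) hΘc
    (twisted_newton_slot_loss ι Λ pM pT L Θ E hΛ hα1 hΛ' hT hTinv hloss hk hE hL hΘ hshiftL)
    (symm_twisted_zero_mem_slot ι pM pT L Θ E hι.injective hΘ).2 (S := (Λ 0 : Set V)) ?_ hchart t₀ hA hAm hAcm
  rintro _ ⟨Z, hZ, rfl⟩
  exact twisted_mem_level_slot_loss ι Λ pM pT Θ E hΛ hα1 hΛ' hT hTinv hloss (n := 0) (by omega) hE hΘ Z hZ

end TubeMeasure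

end Summit.HodgeConjecture.HodgeConjecture.R90.S4
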